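import Summits.QuantumFields.YangMills.Theorems.ColdStartUniversalityLatticeLangevinMarkovProperty
import HarnessLib

/-!
# Route `ColdStartUniversality` (fixed-cut-off SZZ dynamics): ★★★ THE STRONG MARKOV PROPERTY AT COUNTABLY-VALUED STOPPING TIMES —
# `E[Z · G(U_(τ+t))] = E[Z · (κ_t G)(U_τ)]` for `Z` measurable with respect to the `τ`-past

Helper file (seat `ym-line-csu-p1`, g33; `--supports stmt-QuantumFields-24809`).  The Markov property with respect to the driving filtration (file 44,
`integral_mul_comp_add_eq_integral_mul_transition`) extends from deterministic times to random times `τ` taking COUNTABLY MANY values, for every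
strong solution `U` of the SU(2) SZZ dynamics from a deterministic start on ANY probability space and every realising kernel family `κ`:
* ★★★ `integral_mul_comp_stoppingTime_add_eq_of_countable` — elementary form: if `τ` takes values in a countable set `S ⊆ ℝ≥0`, `{τ = s}` is
  `𝓕^W_s`-measurable and `Z·1_(τ = s)` is `𝓕^W_s`-measurable for every `s ∈ S` (i.e. `τ` is a stopping time and `Z` is `𝓕_τ`-measurable), `Z` bounded,
  `G` bounded measurable, then `∫ Z·G(U_(τ+t)) dP = ∫ Z·(∫ G dκ_t(U_τ)) dP` (countable partition `{τ = s}`, file 44 on each piece);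
* ★★★ `integral_mul_comp_stoppingTime_add_eq` — the same with Mathlib's vocabulary: `τ : Ω → ℝ≥0` with `IsStoppingTime 𝓕^W (τ : WithTop)`,
  countable range, `Z` measurable for `IsStoppingTime.measurableSpace`;
* `measurable_comp_countableStoppingTime` — `ω ↦ U_(τ(ω)+t)(ω)` is measurable for countably-valued `τ`.
The general strong Markov property (arbitrary finite stopping times, by dyadic approximation from above as in file 44) is the next file.
THEOREMS ONLY, no definition, no sorry; [folklore] / Revuz–Yor III §3.  HONEST FRAMING: fixed cut-off; structural plumbing; `UniformColdStartMixing`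
(24809) is NOT restated; no crux, rung or summit statement is proved; the Yang–Mills mass gap is NOT proved.
-/

set_option autoImplicit false

noncomputable section

namespace Summit.QuantumFields.YangMills.Theorems.ColdStartUniversality

open MeasureTheory ProbabilityTheory Filter Topology
open scoped NNReal ENNReal BigOperators
open Literature Literature.Probability.Process Literature.MathematicalPhysics.QuantumFieldTheory
open Literature.MathematicalPhysics.QuantumLattice (fundamentalRep fundamentalLatticeRep continuous_fundamentalRep)

variable {L : ℕ} [NeZero L]

/-! ## §1. Measurability of the process read at a countably-valued random time -/

/-- `ω ↦ U_(τ(ω) + t)(ω)` is measurable when `τ` takes values in a countable set with measurable level sets and each `U_u` is measurable. [folklore] -/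
theorem measurable_comp_countableStoppingTime {Ω X : Type*} [MeasurableSpace Ω] [MeasurableSpace X]
    {U : ℝ≥0 → Ω → X} (hU : ∀ u, Measurable (U u)) {τ : Ω → ℝ≥0} {S : Set ℝ≥0} (hS : S.Countable) (hτS : ∀ ω, τ ω ∈ S)
    (hτm : ∀ s ∈ S, MeasurableSet {ω | τ ω = s}) (t : ℝ≥0) :
    Measurable fun ω => U (τ ω + t) ω := by
  haveI : Countable S := hS.to_subtype
  have hτ' : Measurable fun ω => (⟨τ ω, hτS ω⟩ : S) := by
    refine measurable_to_countable' fun s => ?_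
    have : (fun ω => (⟨τ ω, hτS ω⟩ : S)) ⁻¹' {s} = {ω | τ ω = s.1} := by
      ext ω; simp only [Set.mem_preimage, Set.mem_singleton_iff, Set.mem_setOf_eq, Subtype.ext_iff]
    rw [this]; exact hτm s.1 s.2
  have hΦ : Measurable fun q : Ω × S => U (q.2.1 + t) q.1 :=
    measurable_from_prod_countable_left (f := fun q : Ω × S => U (q.2.1 + t) q.1) fun s => by simpa using hU (s.1 + t)
  exact hΦ.comp (measurable_id.prodMk hτ')

/-! ## §2. The strong Markov property at countably-valued stopping times (elementary form) -/

/-- ★★★ **Strong Markov property at a countably-valued stopping time (elementary hypotheses).**  Let `U` be a strong solution from a deterministic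
start on any space, `τ : Ω → ℝ≥0` with values in a countable set `S`, such that for every `s ∈ S` the event `{τ = s}` and the function `Z·1_(τ = s)`
are measurable for `σ(W_u : u ≤ s)` (`τ` a stopping time, `Z` `𝓕_τ`-measurable), `Z` bounded and `G` bounded measurable.  Then
`∫ Z·G(U_(τ+t)) dP = ∫ Z·(∫ G dκ_t(U_τ)) dP`. [cite: RevuzYor1999, Ch. III §3] -/
theorem integral_mul_comp_stoppingTime_add_eq_of_countable (β' : ℝ)
    (κ : ℝ≥0 → Kernel (GaugeConfig 3 L (Matrix.specialUnitaryGroup (Fin 2) ℂ))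
      (GaugeConfig 3 L (Matrix.specialUnitaryGroup (Fin 2) ℂ))) [∀ t, IsMarkovKernel (κ t)]
    (hreal : ∀ (t : ℝ≥0) (x : GaugeConfig 3 L (Matrix.specialUnitaryGroup (Fin 2) ℂ))
        (Ω : Type) [MeasurableSpace Ω] (P : Measure Ω) [IsProbabilityMeasure P]
        (W : ℝ≥0 → Ω → (Edge 3 L × NoiseIdx 2 → ℝ)) (hW : IsFlatBrownian W P)
        (U : ℝ≥0 → Ω → GaugeConfig 3 L (Matrix.specialUnitaryGroup (Fin 2) ℂ)),
        (∀ ω, U 0 ω = x) →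
        (latticeLangevinDynamics (fundamentalLatticeRep 2) β').IsSolution (fundamentalRep (Fin 2))
          hW.natFiltration P W U →
        κ t x = P.map (U t))
    (x : GaugeConfig 3 L (Matrix.specialUnitaryGroup (Fin 2) ℂ))
    {Ω : Type} [MeasurableSpace Ω] {P : Measure Ω} [IsProbabilityMeasure P]
    {W : ℝ≥0 → Ω → (Edge 3 L × NoiseIdx 2 → ℝ)} (hW : IsFlatBrownian W P)
    {U : ℝ≥0 → Ω → GaugeConfig 3 L (Matrix.specialUnitaryGroup (Fin 2) ℂ)} (hU0 : ∀ ω, U 0 ω = x)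
    (hU : (latticeLangevinDynamics (fundamentalLatticeRep 2) β').IsSolution (fundamentalRep (Fin 2)) hW.natFiltration P W U)
    {τ : Ω → ℝ≥0} {S : Set ℝ≥0} (hS : S.Countable) (hτS : ∀ ω, τ ω ∈ S)
    (hτm : ∀ s ∈ S, MeasurableSet[hW.natFiltration s] {ω | τ ω = s}) (t : ℝ≥0)
    {Z : Ω → ℝ} (hZ : ∀ s ∈ S, Measurable[hW.natFiltration s] ({ω | τ ω = s}.indicator Z)) {CZ : ℝ} (hZb : ∀ ω, |Z ω| ≤ CZ)
    {G : GaugeConfig 3 L (Matrix.specialUnitaryGroup (Fin 2) ℂ) → ℝ} (hG : Measurable G) {CG : ℝ} (hGb : ∀ z, |G z| ≤ CG) :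
    ∫ ω, Z ω * G (U (τ ω + t) ω) ∂P = ∫ ω, Z ω * (∫ z, G z ∂(κ t (U (τ ω) ω))) ∂P := by
  classical
  haveI : Countable S := hS.to_subtype
  have hmU : ∀ u : ℝ≥0, Measurable (U u) := fun u => (hU.adapted u).mono (hW.natFiltration.le u) le_rfl
  have hτm0 : ∀ s ∈ S, MeasurableSet {ω | τ ω = s} := fun s hs => (hW.natFiltration.le s) _ (hτm s hs)
  have hτ' : Measurable fun ω => (⟨τ ω, hτS ω⟩ : S) := by
    refine measurable_to_countable' fun s => ?_
    have : (fun ω => (⟨τ ω, hτS ω⟩ : S)) ⁻¹' {s} = {ω | τ ω = s.1} := by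
      ext ω; simp only [Set.mem_preimage, Set.mem_singleton_iff, Set.mem_setOf_eq, Subtype.ext_iff]
    rw [this]; exact hτm0 s.1 s.2
  -- `Z` is measurable (glue the `𝓕_s`-measurable pieces `Z·1_(τ=s)` along `ω ↦ τ ω`)
  have hZs : ∀ s : S, Measurable ({ω | τ ω = s.1}.indicator Z) := fun s => (hZ s.1 s.2).mono (hW.natFiltration.le s.1) le_rfl
  have hZm : Measurable Z := by
    have hΦ : Measurable fun q : Ω × S => ({ω | τ ω = q.2.1}.indicator Z) q.1 :=
      measurable_from_prod_countable_left (f := fun q : Ω × S => ({ω | τ ω = q.2.1}.indicator Z) q.1) fun s => by simpa using hZs s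
    have h := hΦ.comp (measurable_id.prodMk hτ')
    have hfun : ((fun q : Ω × S => ({ω | τ ω = q.2.1}.indicator Z) q.1) ∘ fun ω => (id ω, (⟨τ ω, hτS ω⟩ : S))) = Z := by
      funext ω
      simp only [Function.comp_apply, id_eq]
      exact Set.indicator_of_mem (by simp) Z
    rw [hfun] at h
    exact h
  -- the two processes read at `τ + t` and `τ`
  have hUτt : Measurable fun ω => U (τ ω + t) ω := measurable_comp_countableStoppingTime hmU hS hτS hτm0 t
  have hUτ : Measurable fun ω => U (τ ω) ω := by
    have h := measurable_comp_countableStoppingTime hmU hS hτS hτm0 0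
    simpa only [add_zero] using h
  have hκGm : Measurable fun y => ∫ z, G z ∂(κ t y) := (hG.stronglyMeasurable.integral_kernel (κ := κ t)).measurable
  have hκGb : ∀ y, |∫ z, G z ∂(κ t y)| ≤ CG := fun y => by
    have hh := norm_integral_le_of_norm_le_const (μ := κ t y) (f := G) (C := CG)
      (Eventually.of_forall fun z => by simpa [Real.norm_eq_abs] using hGb z)
    simpa [Real.norm_eq_abs] using hh
  -- integrability of the two integrands
  have hInt : ∀ {φ : Ω → ℝ} {C : ℝ}, Measurable φ → (∀ ω, |φ ω| ≤ C) → Integrable (fun ω => Z ω * φ ω) P := fun hφ hφb =>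
    (integrable_const _).mono' (hZm.mul hφ).aestronglyMeasurable (Eventually.of_forall fun ω => by
      rw [norm_mul, Real.norm_eq_abs, Real.norm_eq_abs]
      exact mul_le_mul (hZb ω) (hφb ω) (abs_nonneg _) ((abs_nonneg _).trans (hZb ω)))
  have iL : Integrable (fun ω => Z ω * G (U (τ ω + t) ω)) P := hInt (hG.comp hUτt) (fun ω => hGb _)
  have iR : Integrable (fun ω => Z ω * (∫ z, G z ∂(κ t (U (τ ω) ω)))) P := hInt (hκGm.comp hUτ) (fun ω => hκGb _)
  -- the countable measurable partition `A s = {τ = s}`, `s ∈ S`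
  set A : S → Set Ω := fun s => {ω | τ ω = s.1} with hA
  have hAm : ∀ s, MeasurableSet (A s) := fun s => hτm0 s.1 s.2
  have hAd : Pairwise (Function.onFun Disjoint A) := by
    intro s s' hss'
    refine Set.disjoint_left.2 fun ω h1 h2 => hss' (Subtype.ext ?_)
    simp only [hA, Set.mem_setOf_eq] at h1 h2
    rw [← h1, ← h2]
  have hAU : (⋃ s, A s) = Set.univ := by
    ext ω
    simp only [Set.mem_iUnion, Set.mem_univ, iff_true]
    exact ⟨⟨τ ω, hτS ω⟩, rfl⟩
  have hsplit : ∀ {φ : Ω → ℝ}, Integrable φ P → ∫ ω, φ ω ∂P = ∑' s : S, ∫ ω in A s, φ ω ∂P := by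
    intro φ hφ
    rw [← setIntegral_univ, ← hAU]
    exact integral_iUnion hAm hAd (hφ.integrableOn)
  rw [hsplit iL, hsplit iR]
  refine tsum_congr fun s => ?_
  -- on the piece `{τ = s}`: the Markov property at the deterministic time `s` with the weight `Z·1_(τ=s)`
  have hZsb : ∀ ω, |(A s).indicator Z ω| ≤ CZ := fun ω => by
    by_cases h : ω ∈ A s
    · rw [Set.indicator_of_mem h]; exact hZb ω
    · rw [Set.indicator_of_notMem h, abs_zero]; exact (abs_nonneg _).trans (hZb ω)
  have hM := integral_mul_comp_add_eq_integral_mul_transition β' κ hreal x hW hU0 hU s.1 t (hZ s.1 s.2) hZsb hG hGb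
  have eL : ∫ ω in A s, Z ω * G (U (τ ω + t) ω) ∂P = ∫ ω, (A s).indicator Z ω * G (U (s.1 + t) ω) ∂P := by
    rw [← integral_indicator (hAm s)]
    refine integral_congr_ae (ae_of_all _ fun ω => ?_)
    show (A s).indicator (fun ω => Z ω * G (U (τ ω + t) ω)) ω = (A s).indicator Z ω * G (U (s.1 + t) ω)
    by_cases h : ω ∈ A s
    · rw [Set.indicator_of_mem h, Set.indicator_of_mem h]
      have hτω : τ ω = s.1 := h
      rw [hτω]
    · rw [Set.indicator_of_notMem h, Set.indicator_of_notMem h, zero_mul]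
  have eR : ∫ ω in A s, Z ω * (∫ z, G z ∂(κ t (U (τ ω) ω))) ∂P = ∫ ω, (A s).indicator Z ω * (∫ z, G z ∂(κ t (U s.1 ω))) ∂P := by
    rw [← integral_indicator (hAm s)]
    refine integral_congr_ae (ae_of_all _ fun ω => ?_)
    show (A s).indicator (fun ω => Z ω * (∫ z, G z ∂(κ t (U (τ ω) ω)))) ω = (A s).indicator Z ω * (∫ z, G z ∂(κ t (U s.1 ω)))
    by_cases h : ω ∈ A s
    · rw [Set.indicator_of_mem h, Set.indicator_of_mem h]
      have hτω : τ ω = s.1 := h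
      rw [hτω]
    · rw [Set.indicator_of_notMem h, Set.indicator_of_notMem h, zero_mul]
  rw [eL, eR, hM]

/-! ## §3. The same in the vocabulary of Mathlib's stopping times -/

/-- For a stopping time `τ` (finite, `WithTop`-valued via the coercion) and an `𝓕_τ`-measurable `Z`, the restriction `Z·1_(τ = s)` is
`𝓕_s`-measurable. [folklore] -/
theorem measurable_indicator_eq_of_isStoppingTime {Ω : Type*} {m : MeasurableSpace Ω} {𝓕 : Filtration ℝ≥0 m} {τ : Ω → ℝ≥0}
    (hτ : IsStoppingTime 𝓕 (fun ω => (τ ω : WithTop ℝ≥0))) {Z : Ω → ℝ} (hZ : Measurable[hτ.measurableSpace] Z) (s : ℝ≥0) :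
    Measurable[𝓕 s] ({ω | τ ω = s}.indicator Z) := by
  have hset : {ω | (fun ω => (τ ω : WithTop ℝ≥0)) ω = (s : WithTop ℝ≥0)} = {ω | τ ω = s} := by
    ext ω; simp only [Set.mem_setOf_eq, WithTop.coe_eq_coe]
  have hA : MeasurableSet[𝓕 s] {ω | τ ω = s} := by
    have h := hτ.measurableSet_eq s
    rwa [hset] at h
  intro B hB
  rw [Set.indicator_preimage]
  refine MeasurableSet.union ?_ ?_
  · -- `Z ⁻¹' B ∩ {τ = s}` is `𝓕_s`-measurable because `Z ⁻¹' B ∈ 𝓕_τ`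
    have h1 : MeasurableSet[hτ.measurableSpace] (Z ⁻¹' B ∩ {ω | (fun ω => (τ ω : WithTop ℝ≥0)) ω = (s : WithTop ℝ≥0)}) :=
      (hZ hB).inter (hτ.measurableSet_eq' s)
    have h2 := (hτ.measurableSet_inter_eq_iff (Z ⁻¹' B) s).1 h1
    rwa [hset] at h2
  · have h0 : Measurable[𝓕 s] (0 : Ω → ℝ) := @measurable_const ℝ Ω _ (𝓕 s) (0 : ℝ)
    exact MeasurableSet.diff (h0 hB) hA

/-- The level sets `{τ = s}` of a (finite) stopping time are `𝓕_s`-measurable. [folklore] -/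
theorem measurableSet_eq_of_isStoppingTime {Ω : Type*} {m : MeasurableSpace Ω} {𝓕 : Filtration ℝ≥0 m} {τ : Ω → ℝ≥0}
    (hτ : IsStoppingTime 𝓕 (fun ω => (τ ω : WithTop ℝ≥0))) (s : ℝ≥0) : MeasurableSet[𝓕 s] {ω | τ ω = s} := by
  have hset : {ω | (fun ω => (τ ω : WithTop ℝ≥0)) ω = (s : WithTop ℝ≥0)} = {ω | τ ω = s} := by
    ext ω; simp only [Set.mem_setOf_eq, WithTop.coe_eq_coe]
  have h := hτ.measurableSet_eq s
  rwa [hset] at h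

/-- ★★★ **Strong Markov property at a countably-valued stopping time** (Mathlib vocabulary): for a strong solution `U` from a deterministic
start on any space, a finite stopping time `τ` of the driving filtration `σ(W_u : u ≤ ·)` with countably many values, an `𝓕_τ`-measurable bounded
`Z` and a bounded measurable `G`: `∫ Z·G(U_(τ+t)) dP = ∫ Z·(∫ G dκ_t(U_τ)) dP`. [cite: RevuzYor1999, Ch. III §3] -/
theorem integral_mul_comp_stoppingTime_add_eq (β' : ℝ)
    (κ : ℝ≥0 → Kernel (GaugeConfig 3 L (Matrix.specialUnitaryGroup (Fin 2) ℂ))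
      (GaugeConfig 3 L (Matrix.specialUnitaryGroup (Fin 2) ℂ))) [∀ t, IsMarkovKernel (κ t)]
    (hreal : ∀ (t : ℝ≥0) (x : GaugeConfig 3 L (Matrix.specialUnitaryGroup (Fin 2) ℂ))
        (Ω : Type) [MeasurableSpace Ω] (P : Measure Ω) [IsProbabilityMeasure P]
        (W : ℝ≥0 → Ω → (Edge 3 L × NoiseIdx 2 → ℝ)) (hW : IsFlatBrownian W P)
        (U : ℝ≥0 → Ω → GaugeConfig 3 L (Matrix.specialUnitaryGroup (Fin 2) ℂ)),
        (∀ ω, U 0 ω = x) →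
        (latticeLangevinDynamics (fundamentalLatticeRep 2) β').IsSolution (fundamentalRep (Fin 2))
          hW.natFiltration P W U →
        κ t x = P.map (U t))
    (x : GaugeConfig 3 L (Matrix.specialUnitaryGroup (Fin 2) ℂ))
    {Ω : Type} [MeasurableSpace Ω] {P : Measure Ω} [IsProbabilityMeasure P]
    {W : ℝ≥0 → Ω → (Edge 3 L × NoiseIdx 2 → ℝ)} (hW : IsFlatBrownian W P)
    {U : ℝ≥0 → Ω → GaugeConfig 3 L (Matrix.specialUnitaryGroup (Fin 2) ℂ)} (hU0 : ∀ ω, U 0 ω = x)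
    (hU : (latticeLangevinDynamics (fundamentalLatticeRep 2) β').IsSolution (fundamentalRep (Fin 2)) hW.natFiltration P W U)
    {τ : Ω → ℝ≥0} (hτ : IsStoppingTime hW.natFiltration (fun ω => (τ ω : WithTop ℝ≥0)))
    {S : Set ℝ≥0} (hS : S.Countable) (hτS : ∀ ω, τ ω ∈ S) (t : ℝ≥0)
    {Z : Ω → ℝ} (hZ : Measurable[hτ.measurableSpace] Z) {CZ : ℝ} (hZb : ∀ ω, |Z ω| ≤ CZ)
    {G : GaugeConfig 3 L (Matrix.specialUnitaryGroup (Fin 2) ℂ) → ℝ} (hG : Measurable G) {CG : ℝ} (hGb : ∀ z, |G z| ≤ CG) :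
    ∫ ω, Z ω * G (U (τ ω + t) ω) ∂P = ∫ ω, Z ω * (∫ z, G z ∂(κ t (U (τ ω) ω))) ∂P :=
  integral_mul_comp_stoppingTime_add_eq_of_countable β' κ hreal x hW hU0 hU hS hτS
    (fun s _ => measurableSet_eq_of_isStoppingTime hτ s) t
    (fun s _ => measurable_indicator_eq_of_isStoppingTime hτ hZ s) hZb hG hGb

end Summit.QuantumFields.YangMills.Theorems.ColdStartUniversality

end
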